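import Literature.Analysis.FluidPDE.HarmonicRemovableSingularity
import Literature.Analysis.FluidPDE.HarmonicVanishing
import HarnessLib

/-!
# A harmonic function sandwiched by Coulomb tails is the Wick sum
(route `CanonicalBranchRefutation`, crux item stmt-CriticalPhenomena-15520
`CanonicalDimensionIsWick`, line `registered`, stub `stub_harmonicPairSandwichIsWick` = support
item `HarmonicPairSandwichIsWick`, stmt-CriticalPhenomena-15525, verbatim)

THEOREM-ONLY file (no definitions, no named facts). Pure potential theory on `ℝ³`: let
`p : Fin 3 → ℝ³` be three distinct poles, `w : Fin 3 → ℝ` weights and `F : ℝ³ → ℝ` harmonic on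
`(range p)ᶜ` with, off the poles,

  `w j ‖y - p j‖⁻¹ ≤ F y` for each `j`,   and   `F y ≤ W y := ∑ j, w j ‖y - p j‖⁻¹`.

Then `F = W` off the poles.

Proof. `U := F - W` is harmonic off the poles (each Coulomb tail `‖· - q‖⁻¹` is harmonic off `q`
in dimension `3`, tree `harmonicAt_norm_sub_sq_rpow`), and the sandwich gives `U ≤ 0` and
`U ≥ -∑_{k ≠ j} w k ‖y - p k‖⁻¹` for each `j`, so `|U y| ≤ ∑_{k ≠ j} w k ‖y - p k‖⁻¹`: a majorant
continuous at `p j` (the poles are distinct), hence `U` is bounded near each pole, and tending to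
`0` at infinity. The three bounded isolated singularities are removable (tree
`exists_harmonicOnNhd_univ_eq_of_finset`): `U` agrees off the poles with an entire harmonic `V`,
`V → 0` along `cocompact`, so `V = 0` (tree `harmonic_eq_zero_of_tendsto_cocompact`, Liouville for
harmonic functions vanishing at infinity) and `F = W` off the poles.

References: S. Axler, P. Bourdon, W. Ramey, *Harmonic Function Theory* (2001), Ch. 2
(Liouville's theorem; isolated singularities of bounded harmonic functions are removable)
[AxlerBourdonRamey2001]; G. B. Folland, *Introduction to Partial Differential Equations* (1995),
Ch. 2 [Folland1995PDE].
-/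

noncomputable section

namespace Summit.CriticalPhenomena.Ising3DConformalLimit.Cruxes.CanonicalDimensionIsWick.Birth

open Filter Topology Metric Set Function InnerProductSpace
open Literature.Analysis.FluidPDE

/-! ### The Coulomb tail `y ↦ c ‖y - q‖⁻¹` in `ℝ³` -/

/-- The Coulomb tail `y ↦ c ‖y - q‖⁻¹` is harmonic at every `y ≠ q` of `ℝ³` (tree
`harmonicAt_norm_sub_sq_rpow` in dimension `3`: `(‖y - q‖²)^{-1/2} = ‖y - q‖⁻¹`). [folklore] -/
theorem harmonicAt_const_mul_norm_sub_inv {x q : EuclideanSpace ℝ (Fin 3)} (c : ℝ) (hx : x ≠ q) :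
    HarmonicAt (fun y => c * ‖y - q‖⁻¹) x := by
  have hk := harmonicAt_norm_sub_sq_rpow q hx
  rw [finrank_euclideanSpace_fin] at hk
  have e : (fun y : EuclideanSpace ℝ (Fin 3) => (‖y - q‖ ^ 2) ^ (-((((3 : ℕ) : ℝ) - 2) / 2))) =
      fun y => ‖y - q‖⁻¹ := by
    funext y
    rw [show (-((((3 : ℕ) : ℝ) - 2) / 2) : ℝ) = -(1 / 2) by norm_num, Real.rpow_neg (sq_nonneg _),
      ← Real.sqrt_eq_rpow, Real.sqrt_sq (norm_nonneg _)]
  rw [e] at hk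
  simpa only [Pi.smul_def, smul_eq_mul] using hk.const_smul (c := c)

/-- The Coulomb tail `y ↦ c ‖y - q‖⁻¹` is continuous at every `y ≠ q`. [folklore] -/
theorem continuousAt_const_mul_norm_sub_inv {x q : EuclideanSpace ℝ (Fin 3)} (c : ℝ) (hx : x ≠ q) :
    ContinuousAt (fun y => c * ‖y - q‖⁻¹) x :=
  (harmonicAt_const_mul_norm_sub_inv c hx).1.continuousAt

/-- The Coulomb tail `c ‖y - q‖⁻¹ → 0` as `‖y‖ → ∞`. [folklore] -/
theorem tendsto_const_mul_norm_sub_inv_cocompact (q : EuclideanSpace ℝ (Fin 3)) (c : ℝ) :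
    Tendsto (fun y => c * ‖y - q‖⁻¹) (cocompact (EuclideanSpace ℝ (Fin 3))) (𝓝 0) := by
  have h0 := tendsto_atTop_add_const_right (cocompact _) (-‖q‖)
    (tendsto_norm_cocompact_atTop (E := EuclideanSpace ℝ (Fin 3)))
  have h1 : Tendsto (fun y : EuclideanSpace ℝ (Fin 3) => ‖y - q‖) (cocompact _) atTop :=
    tendsto_atTop_mono (fun y => by linarith [norm_sub_norm_le y q]) h0
  simpa using h1.inv_tendsto_atTop.const_mul c

/-! ### The registered stub -/

/-- **STUB D = support item `HarmonicPairSandwichIsWick` (stmt-CriticalPhenomena-15525, verbatim).**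
A function `F` harmonic off three distinct poles `p j` of `ℝ³` and sandwiched, off the poles,
between each Coulomb tail `w j ‖y - p j‖⁻¹` from below and their sum `W y = ∑ j, w j ‖y - p j‖⁻¹`
from above equals `W` off the poles: `U = F - W ≤ 0` is harmonic off the poles with
`|U| ≤ ∑_{k ≠ j} w k ‖· - p k‖⁻¹` for each `j`, so bounded near each pole (removable isolated
singularities, tree `exists_harmonicOnNhd_univ_eq_of_finset`) and `→ 0` at infinity, hence its
entire harmonic extension vanishes (tree `harmonic_eq_zero_of_tendsto_cocompact`). The sign
hypothesis on `w` is not needed.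
[cite: AxlerBourdonRamey2001, Ch. 2, Liouville's theorem and Thm. 2.3 (removable singularities)] -/
theorem stub_harmonicPairSandwichIsWick :
    ∀ (p : Fin 3 → EuclideanSpace ℝ (Fin 3)) (w : Fin 3 → ℝ) (F : EuclideanSpace ℝ (Fin 3) → ℝ),
      Function.Injective p → (∀ j, 0 ≤ w j) →
      InnerProductSpace.HarmonicOnNhd F (Set.range p)ᶜ →
      (∀ y ∉ Set.range p, ∀ j, w j * ‖y - p j‖⁻¹ ≤ F y) →
      (∀ y ∉ Set.range p, F y ≤ ∑ j, w j * ‖y - p j‖⁻¹) →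
      ∀ y ∉ Set.range p, F y = ∑ j, w j * ‖y - p j‖⁻¹ := by
  intro p w F hp _ hF hlo hup x₀ hx₀
  classical
  -- the difference `U = F - W` (values at the poles irrelevant)
  set U : EuclideanSpace ℝ (Fin 3) → ℝ := fun y => F y - ∑ j, w j * ‖y - p j‖⁻¹ with hU
  have hpne : ∀ {i j : Fin 3}, i ≠ j → p i ≠ p j := fun hij h => hij (hp h)
  have hUx : ∀ x, U x = F x - (w 0 * ‖x - p 0‖⁻¹ + w 1 * ‖x - p 1‖⁻¹ + w 2 * ‖x - p 2‖⁻¹) :=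
    fun x => by simp only [hU, Fin.sum_univ_three]
  -- SQUEEZE: `|U x| ≤` (the two tails regular at `p i`), `i = 0, 1, 2`
  have hsq : ∀ x, x ∉ range p →
      |U x| ≤ w 1 * ‖x - p 1‖⁻¹ + w 2 * ‖x - p 2‖⁻¹ ∧
      |U x| ≤ w 0 * ‖x - p 0‖⁻¹ + w 2 * ‖x - p 2‖⁻¹ ∧
      |U x| ≤ w 0 * ‖x - p 0‖⁻¹ + w 1 * ‖x - p 1‖⁻¹ := by
    intro x hx
    have hupx := hup x hx
    have g0 := hlo x hx 0
    have g1 := hlo x hx 1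
    have g2 := hlo x hx 2
    simp only [Fin.sum_univ_three] at hupx
    have h0 : U x ≤ 0 := by rw [hUx]; linarith
    rw [abs_of_nonpos h0, hUx]
    exact ⟨by linarith, by linarith, by linarith⟩
  -- the finite singular set and harmonicity off it
  set T : Finset (EuclideanSpace ℝ (Fin 3)) := Finset.univ.image p with hT
  have hmemT : ∀ {x}, x ∉ T → x ∉ range p := fun hx hx' => by
    obtain ⟨i, rfl⟩ := hx'
    exact hx (Finset.mem_image_of_mem p (Finset.mem_univ i))
  have hUh : ∀ x ∉ T, HarmonicAt U x := by
    intro x hxT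
    have hx : x ∉ range p := hmemT hxT
    have hP : ∀ i : Fin 3, HarmonicAt (fun y => w i * ‖y - p i‖⁻¹) x := fun i =>
      harmonicAt_const_mul_norm_sub_inv (w i) (fun h => hx ⟨i, h.symm⟩)
    have h := (hF x hx).sub (((hP 0).add (hP 1)).add (hP 2))
    have e : U = F - (((fun y => w 0 * ‖y - p 0‖⁻¹) + fun y => w 1 * ‖y - p 1‖⁻¹) +
        fun y => w 2 * ‖y - p 2‖⁻¹) := by
      funext y; simp only [hUx, Pi.sub_apply, Pi.add_apply]
    rwa [e]
  -- local bounds near the poles from continuous majorants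
  have hbd : ∀ (i : Fin 3) (g : EuclideanSpace ℝ (Fin 3) → ℝ), ContinuousAt g (p i) →
      (∀ x, x ∉ range p → |U x| ≤ g x) →
      ∃ r > 0, ∃ M : ℝ, ∀ x ∈ ball (p i) r, x ∉ T → |U x| ≤ M := by
    intro i g hg hle
    obtain ⟨δ, hδ, h⟩ := Metric.continuousAt_iff.1 hg 1 one_pos
    refine ⟨δ, hδ, |g (p i)| + 1, fun x hx hxT => (hle x (hmemT hxT)).trans ?_⟩
    have h1 := Real.dist_eq _ _ ▸ h hx
    linarith [le_abs_self (g x), abs_sub_abs_le_abs_sub (g x) (g (p i))]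
  have hc : ∀ {i j : Fin 3}, i ≠ j → ContinuousAt (fun y => w j * ‖y - p j‖⁻¹) (p i) :=
    fun hij => continuousAt_const_mul_norm_sub_inv (w _) (hpne hij)
  have hb : ∀ q ∈ T, ∃ r > 0, ∃ M : ℝ, ∀ x ∈ ball q r, x ∉ T → |U x| ≤ M := by
    intro q hq
    obtain ⟨i, -, rfl⟩ := Finset.mem_image.1 hq
    fin_cases i
    · exact hbd 0 _ ((hc (by decide)).add (hc (by decide))) fun x hx => (hsq x hx).1
    · exact hbd 1 _ ((hc (by decide)).add (hc (by decide))) fun x hx => (hsq x hx).2.1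
    · exact hbd 2 _ ((hc (by decide)).add (hc (by decide))) fun x hx => (hsq x hx).2.2
  -- EXTENSION to an entire harmonic function, DECAY at infinity, LIOUVILLE
  obtain ⟨V, hV, hVU⟩ :=
    exists_harmonicOnNhd_univ_eq_of_finset (le_of_eq finrank_euclideanSpace_fin.symm) T hUh hb
  have hV0 : Tendsto V (cocompact _) (𝓝 0) := by
    have hq : Tendsto (fun x => w 1 * ‖x - p 1‖⁻¹ + w 2 * ‖x - p 2‖⁻¹)
        (cocompact (EuclideanSpace ℝ (Fin 3))) (𝓝 0) := by
      simpa using (tendsto_const_mul_norm_sub_inv_cocompact (p 1) (w 1)).add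
        (tendsto_const_mul_norm_sub_inv_cocompact (p 2) (w 2))
    refine squeeze_zero_norm' ?_ hq
    filter_upwards [T.finite_toSet.isCompact.compl_mem_cocompact] with x hx
    have hx' : x ∉ T := fun h => hx (by simpa using h)
    rw [Real.norm_eq_abs, hVU x hx']
    exact (hsq x (hmemT hx')).1
  have hVz := harmonic_eq_zero_of_tendsto_cocompact hV hV0
  have hx₀T : x₀ ∉ T := fun h => by
    obtain ⟨i, -, hi⟩ := Finset.mem_image.1 h
    exact hx₀ ⟨i, hi⟩
  have key : U x₀ = 0 := by simpa [hVz] using (hVU x₀ hx₀T).symm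
  exact sub_eq_zero.1 key

end Summit.CriticalPhenomena.Ising3DConformalLimit.Cruxes.CanonicalDimensionIsWick.Birth

end
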